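import Summits.SmoothPoincare4.SmoothPoincare4.Theorems.ConvexBisectionAcyclicBisectionExistsDualLinkNodes
import Summits.SmoothPoincare4.SmoothPoincare4.Theorems.ConvexBisectionAcyclicBisectionExistsBeltBasePush
import HarnessLib

/-!
# Seam transport, ST1: the pushed framed page knot is a framed knot in the extended page
(wave 4, brick ST1 `node_ST1_extendedPage` of node T3c-2 `node_seam_transport` of stub
`stub_steinRealisation` = NF6, line `modp-braid-orbits` r11, crux
`ConvexBisection.AcyclicBisectionExists`, item stmt-SmoothPoincare4-10508; registered sub-goal
`helper_seam_extendedPage`)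

Data of a fibred model: `X = Base g ∪_{h̄} (handles)` (data `D`), a boundary datum `bX` of `X`,
the seam `Ψ : bX.carrier ≅ ∂ Base g` and the PAGE CLAUSE `w (Ψ y) = c(y) · w (a)`, `c(y) > 0`,
whenever `bX.incl y = D.jA a`.  A framed page knot `(K ⊂ page g c, ν)` of `∂ Base g` off the cores
is read in `∂X` through lifts `z` of its points (`bX.incl (z θ) = D.jA (K θ)`) and `u` of its
framing vectors (`d(bX.incl)(u θ) = d(jA)(ν θ)`) — the format in which node T3c-2 consumes the end
data of node T3c-1′ (Z7's contract `…DualLinkAssembly.lean`).  This file proves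
(`seam_extendedPage`, registered as `helper_seam_extendedPage`):

* the pushed knot `θ ↦ (bBase g).incl (Ψ (z θ))` is a knot in `∂ Base g` and the pushed vectors
  `d((bBase g).incl ∘ Ψ)_{z θ}(u θ)` are a framing of it — the lifts are FORCED: `bX.incl` is
  injective, so `z = R ∘ knotLift` for the restriction `R : ∂X ≅ bX.carrier` of the identity
  (`incl_restrict_refl`), and `d(bX.incl)` is injective, so `u = dR (tail (d jA ν))`
  (`mfderiv_incl_tail`); then Z5's `isBoundaryKnot_jA_comp` / `isKnotFraming_jA_push`, Z7's
  `helper_isKnotFraming_seamPush` for `seamDiffeo bX (bBase g) Ψ`, read back through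
  `coe_seamDiffeo` / `mfderiv_seamDiffeo`;
* it lies in `{rho = 1/4}` (a boundary point of the regular sublevel set `Base g`) and in the
  EXTENDED PAGE of direction `c`: `w = r · c` with `r > 0` (page clause at `a = K θ`, where
  `w = c / 2`).

Everything is proved; no named facts, no `sorry`.  References: A. Kosinski, *Differential
Manifolds* (1993), VI §6 [Kosinski1993]; J. M. Lee, *Introduction to Smooth Manifolds* (2013),
Thm. 5.11 [LeeSmoothManifolds2013].
-/

noncomputable section

set_option linter.dupNamespace false

open scoped Manifold ContDiff Topology

namespace Summit.SmoothPoincare4.SmoothPoincare4.Theorems.AcyclicBisectionExists.ModpBraidOrbits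

open Set Function Filter Metric Topology Bundle
open Literature.Topology.FourManifolds Literature.Topology.FourManifolds.HandleAttachingMap
  Literature.Topology.FourManifolds.BoundaryManifold Literature.Topology.FourManifolds.LefschetzBase
  Literature.Geometry.Symplectic

section ExtendedPage

variable {g : ℕ} {ι : Type} [Finite ι] {h : ι → HandleAttachingMap 3 2 (Base g)}
  {X : Type} [TopologicalSpace X] [T2Space X] [ChartedSpace (EuclideanHalfSpace 4) X]
  [IsManifold (𝓡∂ 4) ∞ X]
  (D : MultiAttachmentData h (𝓡∂ 4) X) (bX : BoundaryData (𝓡∂ 4) X (𝓡 3))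
  (Ψ : bX.carrier ≃ₘ⟮𝓡 3, 𝓡 3⟯ (bBase g).carrier)

omit [T2Space X] in
/-- The differential of the inclusion of a boundary datum is injective (the inclusion is an
immersion). [cite: LeeSmoothManifolds2013, Thm. 5.11] -/
theorem injective_mfderiv_boundaryIncl (y : bX.carrier) :
    Injective (mfderiv (𝓡 3) (𝓡∂ 4) bX.incl y) := by
  obtain ⟨F, _, _, hF⟩ := bX.isSmoothEmbedding.isImmersion
  exact Manifold.IsImmersionAtOfComplement.mfderiv_injective (hF y) (by simp)

omit [T2Space X] in
/-- **The lift of the points is forced**: if `bX.incl (z θ) = D.jA (K θ)` then `z θ` is the image,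
under the restriction `R : ∂X ≅ bX.carrier` of the identity, of the canonical lift `knotLift`.
[cite: LeeSmoothManifolds2013, Thm. 5.11] -/
theorem restrict_knotLift_eq {K : sphere (0 : EuclideanSpace ℝ (Fin 2)) 1 → Base g}
    {hK : ∀ θ, K θ ∈ coresComplement h} (hKX : IsBoundaryKnot fun θ => D.jA ⟨K θ, hK θ⟩)
    {z : sphere (0 : EuclideanSpace ℝ (Fin 2)) 1 → bX.carrier}
    (hz : ∀ θ, bX.incl (z θ) = D.jA ⟨K θ, hK θ⟩) (θ : sphere (0 : EuclideanSpace ℝ (Fin 2)) 1) :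
    (BoundaryManifold.boundaryData 3 X).restrictDiffeomorph bX (Diffeomorph.refl (𝓡∂ 4) X ∞)
      (knotLift hKX θ) = z θ :=
  bX.injective_incl (by rw [incl_restrict_refl, hz]; rfl)

omit [T2Space X] in
/-- **The lift of the framing vectors is forced**: if `d(bX.incl)(u θ) = d(jA)(ν θ)` then `u θ` is
`dR` of the tail of `d(jA)(ν θ)` at the canonical lift. [cite: LeeSmoothManifolds2013, Thm. 5.11] -/
theorem restrict_tail_eq {K : sphere (0 : EuclideanSpace ℝ (Fin 2)) 1 → Base g}
    {hK : ∀ θ, K θ ∈ coresComplement h} (hKX : IsBoundaryKnot fun θ => D.jA ⟨K θ, hK θ⟩)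
    {ν : sphere (0 : EuclideanSpace ℝ (Fin 2)) 1 → EuclideanSpace ℝ (Fin 4)}
    (hνX : IsKnotFraming (fun θ => D.jA ⟨K θ, hK θ⟩)
      fun θ => mfderiv (𝓡∂ 4) (𝓡∂ 4) D.jA ⟨K θ, hK θ⟩ (ν θ))
    {z : sphere (0 : EuclideanSpace ℝ (Fin 2)) 1 → bX.carrier}
    (hz : ∀ θ, bX.incl (z θ) = D.jA ⟨K θ, hK θ⟩)
    {u : sphere (0 : EuclideanSpace ℝ (Fin 2)) 1 → EuclideanSpace ℝ (Fin 3)}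
    (hu : ∀ θ, mfderiv (𝓡 3) (𝓡∂ 4) bX.incl (z θ) (u θ) =
      mfderiv (𝓡∂ 4) (𝓡∂ 4) (fun a : ↥(coresComplement h) => D.jA a) ⟨K θ, hK θ⟩ (ν θ))
    (θ : sphere (0 : EuclideanSpace ℝ (Fin 2)) 1) :
    mfderiv (𝓡 3) (𝓡 3)
        ((BoundaryManifold.boundaryData 3 X).restrictDiffeomorph bX (Diffeomorph.refl (𝓡∂ 4) X ∞))
        (knotLift hKX θ) (tail 3 (mfderiv (𝓡∂ 4) (𝓡∂ 4) D.jA ⟨K θ, hK θ⟩ (ν θ))) = u θ := by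
  set R := (BoundaryManifold.boundaryData 3 X).restrictDiffeomorph bX (Diffeomorph.refl (𝓡∂ 4) X ∞)
    with hR
  have hV0 := (mem_boundaryTangentSpace_iff _).1 (hνX.mem_boundaryTangentSpace θ)
  have hRz : R (knotLift hKX θ) = z θ := restrict_knotLift_eq D bX hKX hz θ
  apply injective_mfderiv_boundaryIncl bX (z θ)
  rw [hu θ]
  -- `d(bX.incl)_{R y} (dR_y (tail V)) = d((boundaryData 3 X).incl)_y (tail V) = V`
  have hRd : HasMFDerivAt (𝓡 3) (𝓡 3) R (knotLift hKX θ) (mfderiv (𝓡 3) (𝓡 3) R (knotLift hKX θ)) :=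
    ((R.contMDiff _).mdifferentiableAt (by simp)).hasMFDerivAt
  have hId : HasMFDerivAt (𝓡 3) (𝓡∂ 4) bX.incl (R (knotLift hKX θ))
      (mfderiv (𝓡 3) (𝓡∂ 4) bX.incl (R (knotLift hKX θ))) :=
    ((bX.isSmoothEmbedding.contMDiff _).mdifferentiableAt (by simp)).hasMFDerivAt
  have hcomp := hId.comp _ hRd
  have hfun : (bX.incl ∘ R) = (BoundaryManifold.boundaryData 3 X).incl :=
    funext fun y => incl_restrict_refl bX y
  have h2 : mfderiv (𝓡 3) (𝓡∂ 4) (BoundaryManifold.boundaryData 3 X).incl (knotLift hKX θ) =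
      (mfderiv (𝓡 3) (𝓡∂ 4) bX.incl (R (knotLift hKX θ))).comp
        (mfderiv (𝓡 3) (𝓡 3) R (knotLift hKX θ)) := by
    rw [← hfun]
    exact hcomp.mfderiv
  have h3 := mfderiv_incl_tail (knotLift hKX θ) hV0
  rw [h2] at h3
  rw [← hRz]
  exact h3

/-- **ST1 — the pushed framed page knot is a framed knot of `∂ Base g` in the extended page.**  For
the data `(D, bX, Ψ)` with the page clause, a framed page knot `(K ⊂ page g c, ν)` off the cores
with lifts `z` (points) and `u` (framing vectors) through `bX.incl`: the pushed knot
`θ ↦ (bBase g).incl (Ψ (z θ))` is a knot in `∂ Base g`, the pushed vectors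
`d((bBase g).incl ∘ Ψ)_{z θ}(u θ)` are a framing of it, it lies in `{rho = 1/4}` and `w = r · c` with
`r > 0` along it. [cite: Kosinski1993, VI §6] -/
theorem seam_extendedPage
    (hpage : ∀ (y : bX.carrier) (a : ↥(coresComplement h)), bX.incl y = D.jA a →
      ∃ c : ℝ, 0 < c ∧ w g ((bBase g).incl (Ψ y)).1 = (c : ℂ) * w g (a : Base g).1)
    (c : ℂ) (K : sphere (0 : EuclideanSpace ℝ (Fin 2)) 1 → Base g)
    (ν : sphere (0 : EuclideanSpace ℝ (Fin 2)) 1 → EuclideanSpace ℝ (Fin 4))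
    (hK : ∀ θ, K θ ∈ coresComplement h) (hKp : ∀ θ, K θ ∈ page g c)
    (hKb : IsBoundaryKnot K) (hKν : IsKnotFraming K ν)
    (z : sphere (0 : EuclideanSpace ℝ (Fin 2)) 1 → bX.carrier)
    (hz : ∀ θ, bX.incl (z θ) = D.jA ⟨K θ, hK θ⟩)
    (u : sphere (0 : EuclideanSpace ℝ (Fin 2)) 1 → EuclideanSpace ℝ (Fin 3))
    (hu : ∀ θ, mfderiv (𝓡 3) (𝓡∂ 4) bX.incl (z θ) (u θ) =
      mfderiv (𝓡∂ 4) (𝓡∂ 4) (fun a : ↥(coresComplement h) => D.jA a) ⟨K θ, hK θ⟩ (ν θ)) :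
    IsBoundaryKnot (fun θ => ((bBase g).incl (Ψ (z θ)) : Base g)) ∧
    IsKnotFraming (fun θ => ((bBase g).incl (Ψ (z θ)) : Base g))
      (fun θ => mfderiv (𝓡 3) (𝓡∂ 4) (fun y => ((bBase g).incl (Ψ y) : Base g)) (z θ) (u θ)) ∧
    (∀ θ, rho g ((bBase g).incl (Ψ (z θ)) : Base g).1 = 1 / 4) ∧
    (∀ θ, ∃ r : ℝ, 0 < r ∧ w g ((bBase g).incl (Ψ (z θ)) : Base g).1 = (r : ℂ) * c) := by
  -- the framed knot read in `X`
  have hKX : IsBoundaryKnot fun θ => D.jA ⟨K θ, hK θ⟩ := isBoundaryKnot_jA_comp D hKb hK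
  have hνX : IsKnotFraming (fun θ => D.jA ⟨K θ, hK θ⟩)
      fun θ => mfderiv (𝓡∂ 4) (𝓡∂ 4) D.jA ⟨K θ, hK θ⟩ (ν θ) := isKnotFraming_jA_push D hKb hK hKν
  -- push through the seam diffeomorphism of the canonical carriers (Z7)
  obtain ⟨hb', hfr'⟩ := helper_isKnotFraming_seamPush (seamDiffeo bX (bBase g) Ψ) _ hKX _ hνX
  -- identify the knots …
  have hRz : ∀ θ, (BoundaryManifold.boundaryData 3 X).restrictDiffeomorph bX (Diffeomorph.refl (𝓡∂ 4) X ∞)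
      (knotLift hKX θ) = z θ := restrict_knotLift_eq D bX hKX hz
  have hknot : (fun θ => (BoundaryManifold.boundaryData 3 (Base g)).incl
      (seamDiffeo bX (bBase g) Ψ (knotLift hKX θ))) = fun θ => ((bBase g).incl (Ψ (z θ)) : Base g) :=
    funext fun θ => by rw [coe_seamDiffeo, hRz]
  -- … and the framings
  have hframe : (fun θ => mfderiv (𝓡 3) (𝓡∂ 4)
      (fun y => (BoundaryManifold.boundaryData 3 (Base g)).incl (seamDiffeo bX (bBase g) Ψ y))
      (knotLift hKX θ) (tail 3 (mfderiv (𝓡∂ 4) (𝓡∂ 4) D.jA ⟨K θ, hK θ⟩ (ν θ)))) =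
      fun θ => mfderiv (𝓡 3) (𝓡∂ 4) (fun y => ((bBase g).incl (Ψ y) : Base g)) (z θ) (u θ) := by
    funext θ
    rw [← mfderiv_seamDiffeo bX (bBase g) Ψ, restrict_tail_eq D bX hKX hνX hz hu θ, hRz]
  rw [hknot] at hb'
  rw [hknot, hframe] at hfr'
  refine ⟨hb', hfr', fun θ => ?_, fun θ => ?_⟩
  · exact (RegularSublevel.mem_boundary_iff (isRegularLevel_rho g) _).1 ((bBase g).incl_mem_boundary _)
  · obtain ⟨c', hc', hw⟩ := hpage (z θ) ⟨K θ, hK θ⟩ (hz θ)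
    refine ⟨c' / 2, by positivity, ?_⟩
    rw [hw, (hKp θ).2]
    push_cast
    ring

/-- **Sub-goal `helper_seam_extendedPage` of stub `stub_steinRealisation`** (NF6 ▸ T3 ▸ T3c-2 ▸ ST1
`node_ST1_extendedPage`; wave 4, lead c5): for the data `(D, bX, Ψ)` of a fibred model with the page
clause (`w (Ψ y) = c · w a`, `c > 0`, whenever `bX.incl y = D.jA a`), a framed page knot
`(K ⊂ page g c, ν)` of `∂ Base g` off the cores, and lifts `z`, `u` of its points and framing vectors
through `bX.incl` (`bX.incl (z θ) = D.jA (K θ)`, `d(bX.incl)(u θ) = d(jA)(ν θ)`): the pushed knot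
`θ ↦ (bBase g).incl (Ψ (z θ))` is a knot in `∂ Base g`, the pushed vectors are a framing of it, it
lies in `{rho = 1/4}`, and in the extended page of direction `c` (`w = r · c`, `r > 0`).
[cite: Kosinski1993, VI §6] -/
theorem helper_seam_extendedPage : ∀ (g : ℕ) (ι : Type) [Finite ι] (h : ι → Literature.Topology.FourManifolds.HandleAttachingMap 3 2 (Literature.Topology.FourManifolds.LefschetzBase.Base g)) (X : Type) [TopologicalSpace X] [T2Space X] [ChartedSpace (EuclideanHalfSpace 4) X] [IsManifold (𝓡∂ 4) ∞ X] (D : Literature.Topology.FourManifolds.HandleAttachingMap.MultiAttachmentData h (𝓡∂ 4) X) (bX : Literature.Topology.FourManifolds.BoundaryData (𝓡∂ 4) X (𝓡 3)) (Ψ : bX.carrier ≃ₘ⟮𝓡 3, 𝓡 3⟯ (Literature.Topology.FourManifolds.LefschetzBase.bBase g).carrier), (∀ (y : bX.carrier) (a : ↥(Literature.Topology.FourManifolds.HandleAttachingMap.coresComplement h)), bX.incl y = D.jA a → ∃ c : ℝ, 0 < c ∧ Literature.Topology.FourManifolds.LefschetzBase.w g ((Literature.Topology.FourManifolds.LefschetzBase.bBase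 g).incl (Ψ y)).1 = (c : ℂ) * Literature.Topology.FourManifolds.LefschetzBase.w g (a : Literature.Topology.FourManifolds.LefschetzBase.Base g).1) → ∀ (c : ℂ) (K : Metric.sphere (0 : EuclideanSpace ℝ (Fin 2)) 1 → Literature.Topology.FourManifolds.LefschetzBase.Base g) (ν : Metric.sphere (0 : EuclideanSpace ℝ (Fin 2)) 1 → EuclideanSpace ℝ (Fin 4)) (hK : ∀ θ, K θ ∈ Literature.Topology.FourManifolds.HandleAttachingMap.coresComplement h), (∀ θ, K θ ∈ Literature.Topology.FourManifolds.LefschetzBase.page g c) → Literature.Geometry.Symplectic.IsBoundaryKnot K → Literature.Geometry.Symplectic.IsKnotFraming K ν → ∀ (z : Metric.sphere (0 : EuclideanSpace ℝ (Fin 2)) 1 → bX.carrier), (∀ θ, bX.incl (z θ) = D.jA ⟨K θ, hK θ⟩) → ∀ (u : Metric.sphere (0 : EuclideanSpace ℝ (Fin 2)) 1 → EuclideanSpace ℝ (Fin 3)), (∀ θ, mfderiv (𝓡 3) (𝓡∂ 4) bX.incl (z θ) (u θ) = mfderiv (𝓡∂ 4) (𝓡∂ 4) (fun a : ↥(Literature.Topology.FourManifolds.HandleAttachingMap.coresComplement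 h) => D.jA a) ⟨K θ, hK θ⟩ (ν θ)) → Literature.Geometry.Symplectic.IsBoundaryKnot (fun θ => ((Literature.Topology.FourManifolds.LefschetzBase.bBase g).incl (Ψ (z θ)) : Literature.Topology.FourManifolds.LefschetzBase.Base g)) ∧ Literature.Geometry.Symplectic.IsKnotFraming (fun θ => ((Literature.Topology.FourManifolds.LefschetzBase.bBase g).incl (Ψ (z θ)) : Literature.Topology.FourManifolds.LefschetzBase.Base g)) (fun θ => mfderiv (𝓡 3) (𝓡∂ 4) (fun y => ((Literature.Topology.FourManifolds.LefschetzBase.bBase g).incl (Ψ y) : Literature.Topology.FourManifolds.LefschetzBase.Base g)) (z θ) (u θ)) ∧ (∀ θ, Literature.Topology.FourManifolds.LefschetzBase.rho g ((Literature.Topology.FourManifolds.LefschetzBase.bBase g).incl (Ψ (z θ)) : Literature.Topology.FourManifolds.LefschetzBase.Base g).1 = 1 / 4) ∧ (∀ θ, ∃ r : ℝ, 0 < r ∧ Literature.Topology.FourManifolds.LefschetzBase.w g ((Literature.Topology.FourManifolds.LefschetzBase.bBase g).incl (Ψ (z θ)) : Literature.Topology.FourManifolds.LefschetzBase.Base g).1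 = (r : ℂ) * c) :=
  fun _ _ _ _ _ _ _ _ _ D bX Ψ hpage c K ν hK hKp hKb hKν z hz u hu =>
    seam_extendedPage D bX Ψ hpage c K ν hK hKp hKb hKν z hz u hu

end ExtendedPage

end Summit.SmoothPoincare4.SmoothPoincare4.Theorems.AcyclicBisectionExists.ModpBraidOrbits

end
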